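/-
Copyright: lit-balaban cell, Phase-2 proof seat p33 (gen 9).  Statement-level skeleton of a published paper; no proof claims beyond
what the kernel checks below.
-/
import Literature.MathematicalPhysics.QuantumFieldTheory.BalabanImbrieJaffe1984to88.BIJ85LineSumHk
import Literature.MathematicalPhysics.QuantumFieldTheory.BalabanImbrieJaffe1984to88.BIJ85Sect72AllToriHolds
import Literature.MathematicalPhysics.QuantumFieldTheory.BalabanImbrieJaffe1984to88.BIJ85ResidualSupBound

/-!
# `BalabanImbrieJaffe1984to88.BIJ85SmoothPotential326` — T. Bałaban, J. Imbrie, A. Jaffe, *Renormalization of the Higgs model: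
minimizers, propagators and the stability of mean field theory*, Commun. Math. Phys. **97** (1985) 299–329 [BalabanImbrieJaffe1985],
Sect. 7.3 p. 326 [PDF 28], the closing paragraph: **the SMOOTH SMALL POTENTIAL of the actual background field (4.5.4) under (7.3.1)** —
*"by change of gauge u_k can be transformed in a local region Λ into a configuration of the form exp[ie_kηA], where A is smooth and small …
This is a local procedure since f^{(k)} can locally be represented as a curl"* — file 1 of 2 (torus-global half: the potential `A = H_kB` and
its bounds; file 2 `BIJ85LocalSmoothGauge326` performs the change of gauge on a local region).

statement-level skeleton of published theorems with citation tags; proofs where landed; nothing here is a claim about the Yang–Mills mass gap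

PDF held: `paper:balaban1985-cmp97-bij-higgs-minimizers` (journal page = PDF page + 298).  Pages read this session (`lit read`, text layer):
pp. 311–313 [PDF 13–15] ((4.3.1)–(4.6.4)), pp. 325–327 [PDF 27–29] ((7.2.1)–(7.2.4), (7.3.1)–(7.3.2) and the closing paragraph of Sect. 7.3).

CITATION HEADER (lean-in-tree rule).  Phase-2 file of the lit-balaban TYPED SKELETON (HOME `run/shared/lean/pub/lit-balaban/`), seat p33
gen 9 (unit `lit-balaban-p33-g9`; TAKING line HOME/STATUS.md 2026-08-22T00:17Z); SKELETON row **C1.Eq7.3.1-7.3.2** (owner r15, referee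
ref-5), the regularity member of the p. 326 sentence *"The propagators arising from Δ_k(u_k) … also satisfy the regularity and decay estimates
of [7]"* — whose printed HYPOTHESIS for [7] = [Balaban1983RegularityDecay] is exactly the existence of this smooth small gauge (G-C1-05
ADDENDUM 6 «WHAT REMAINS» (a)); it is also the η-lattice passage for `u_k` left open in p36's `BIJ88Smooth43Axial` (row C2.Eq4.3 of
[BalabanImbrieJaffe1988]: *"ũ^λ = exp(ie_kηA^λ) with |A^λ|, |∂A^λ|, |∂^*A^λ| ≦ cp(e_k)r(e_k)"*).  Objects BY NAME, nothing re-declared: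
p33 g7's actual background `BIJ85Eq454PlaqResidual.actualBg` with `plaq_actualBg_eq_exp_resE` (`u_k(∂p) = exp(ie_kη²f_k(p))`), p30's Hodge
decomposition `BIJ85UnitTorusHodge.exists_const_add_curl_of_closed` (`f = h + ∂B`, `|B(b)| ≤ (8d+2)s(1 + |b₋ − x₀|₁)²`) and `resE_const`
(`f_k(h) = h`), p33 g7's `BIJ85ResidualMinimizer.resE_dOne_eq_curlOp_HkE` (`f_k(∂B) = ∂^ηH_kB`), p11's Landau minimizer `HkE` ((4.4.2)),
p09 g9's `BIJ85LineSumHk.ofLp_HkE_apply_eq_sum`/`abs_HkE_apply_le_of_growth`/`hH_of_kernelBounds`, p16's hypothesis-free all-tori members of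
(7.2.2) `BIJ85Sect72AllToriHolds.exists_absH_le_allTori` (`|H|`) and `exists_gradB_allTori` (`|∇H|`), p33 g7's closedness of `f^{(k)}`
under (7.3.1) `BIJ85Claim73Closed.dPlaq_plaqField_eq_zero`.  THEOREMS ONLY (no `def`, no named fact; D-0026).

THE PRINTED TEXT, verbatim, p. 326 [PDF 28]: *"These inequalities can be proved by an extension of the proofs of [7]. The propagators
arising from Δ_k(u_k), under the restriction (7.3.1) on the gauge field, also satisfy the regularity and decay estimates of [7]. In order to
remain within the framework of this reference, we remark that by change of gauge u_k can be transformed in a local region Λ into a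
configuration of the form exp[ie_kηA], where A is smooth and small. In axial gauge for the configuration v in a domain Λ′ ⊃ Λ we can
substitute 𝒟_k∂^* = G_{k,Ax}∂^* + ∂D in the formula for u_k, we use (5.3.1) to replace this by a minimizer in axial gauge. Then we use
(5.1.1) to return the minimizers to Landau gauge. This is a local procedure since f^{(k)} can locally be represented as a curl."*

THE ARGUMENT (the printed route, made explicit on the torus).  Under (7.3.1) the unit-lattice plaquette field `f = f^{(k)} = (ie_k)^{−1}ln v(∂·)`
is CLOSED (abelian Bianchi identity), hence on the torus `f = h + ∂B` with `h_{μν}` constant (the flux part, `|h| ≤ max|f|`) and a potential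
`B` small near any chosen unit site `x₀`, `|B(b)| ≤ (8d+2)·max|f|·(1 + |b₋ − x₀|₁)²`.  By Remark 2 p. 317 the η-plaquette variables of the
actual background are `u_k(∂p) = exp(ie_kη²f_k(p))` with `f_k = (I − ∂G_{k,Ax}∂^*)Q^{e*}_kf` ((4.2.6)); on the flux part `f_k(h) = h` and on the
curl `f_k(∂B) = ∂^ηH_kB` — (5.3.1) then (5.2.8)/(5.1.1): *"replace this by a minimizer in axial gauge. Then … return the minimizers to Landau
gauge"* — so that **`u_k(∂p) = exp(ie_kη²·(h_{μν} + (∂^ηH_kB)(p)))`**: the curvature of `u_k` is that of the fine field `exp[ie_kηA]`,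
`A = H_kB + (a linear potential of the constant h)`.  The Landau minimizer `A₁ = H_kB` ((4.4.2), kernel (7.2.1)) is SMOOTH AND SMALL by
the `|H|` and `|∇H|` members of (7.2.2): `|(H_kB)_κ(z)|, |∇^η(H_kB)_κ(z)| ≤ M·(8d+2)·max|f|·C(δ)·(1 + |z_k − x₀|₁)²` — *"with estimates depending on
Λ"* (the growth weight is the price of ONE potential `B` for the whole torus; on a region `Λ` of diameter `R` about `x₀` it is `(1 + R)²`).

WHAT IS PROVED (0 `sorry`, standard axioms; theorems only — proof lane).
* §0 torus bookkeeping (`ℓ¹` triangle inequality, re-centring of quadratic growth weights).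
* §1 **the `|∇H|` member of (7.2.2) in kernel shape for p11's `HkE`**: `hG_of_kernelBounds` — `|L^k((H_ke_{b′})_κ(z + ηe_λ) − (H_ke_{b′})_κ(z))| ≤
  M₀e^{δ/2}e^{−(δ/d)|z_k − b′₋|₁}` from `‖∇H_{k,κν}(z, y)‖ ≤ M₀e^{−δ|z − y|}` (companion of p09's `hH_of_kernelBounds` for the `|H|` member).
* §2 **the forward differences of `H_kB` as kernel sums and their local sup for a potential of quadratic growth**: `fwdDiff_HkE_apply_eq_sum`,
  `abs_fwdDiff_HkE_apply_le_of_growth` (companion of p09's `abs_HkE_apply_le_of_growth`).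
* §3 **one potential for the whole torus**: `abs_HkE_apply_le_of_growth_at` / `abs_fwdDiff_HkE_apply_le_of_growth_at` — with the growth measured
  from a FIXED base site `x₀`, the local sups at `z` carry the weight `(1 + |z_k − x₀|₁)²`.
* §4 **THE CURVATURE OF THE ACTUAL BACKGROUND IS THAT OF `exp[ie_kη(H_kB + a_h)]`**: `plaq_actualBg_eq_exp_hodge` — for every decomposition
  `f^{(k)} = h + ∂B` of the unit plaquette field, `u_k(∂p) = exp(ie_kη²(h_{μ(p)ν(p)} + (∂^{η⁻¹}H_kB)(p)))` EXACTLY (all `k ≤ m + K`, `e ≠ 0`).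
* §5 (7.3.1)-type smallness ⇒ closed and small: `isClosedPlaq_plaqField_of_dev`, `abs_plaqField_le_of_dev'`.
* §6 **`exists_smooth_potential`** (one torus, one scale, kernel-shape hypotheses for `|H|`, `|∇H|`): for every `v` with `|v(∂p) − 1| ≤ t ≤ ½`
  and every base site `x₀` there are `h` (antisymmetric, `|h| ≤ (π/2)t/e`) and `B` with the curvature identity of §4 and
  `|(H_kB)_κ(z)|, |L^k((H_kB)_κ(z+ηe_λ) − (H_kB)_κ(z))| ≤ const·(t/e)·(1 + |z_k − x₀|₁)²`.
* §7 **`exists_smooth_potential_allTori` — HYPOTHESIS-FREE, ONE CONSTANT FOR ALL TORI AND SCALES**: for every `d ≥ 2` and block size `L` there is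
  `K ≥ 0` such that on EVERY torus `P` (`P.d = d`, `P.L = L`), every scale `1 ≤ k ≤ m + K`, every coupling `e > 0`, every unit field `v` with
  `|v(∂p) − 1| ≤ t ≤ ½` and every `x₀`, the conclusion of §6 holds with `const = K`; **`exists_smooth_potential_of_hyp731`**: under (7.3.1)
  verbatim (`t = e_k𝓅(e_k) ≤ ½`) the bounds read `K·𝓅(e_k)·(1 + |z_k − x₀|₁)²` — *"A is smooth and small"*.
HONEST SCOPE.  (i) This file is the torus-global half: the fine field `exp[ie_kηA]` has the SAME CURVATURE as `u_k` everywhere; the gauge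
transformation relating the two exists only on regions without non-contractible loops and is constructed in file 2 (on non-wrapping boxes,
together with the linear potential of the flux part `h`, which is not exact on the torus).  (ii) "smooth" = the sup of `A` and of ALL its
forward η-difference quotients `L^k(A(z + ηe_λ) − A(z))` (hence of `∂A` and `∂^*A`); Hölder quotients of `∇A` are not touched.  (iii) The
regularity estimates of [7] for `G_k(u_k)` themselves (the CONCLUSION of the p. 326 sentence) are NOT proved here — only its printed
hypothesis; see HOME/GAPS.md G-C1-05.  (iv) `U = 1` real abelian fields; torus; standing range `k ≤ m + K`, `2 ≤ d`; constants explicit, not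
optimised; growth weight `(1 + |z_k − x₀|₁)²` = the printed *"estimates depending on Λ"*.  Unit `lit-balaban-p33`
(literature-prover-lit-balaban-p33-g9-0), 2026-08-22.  NOT summit progress.
-/

open scoped BigOperators RealInnerProductSpace

namespace Literature.MathematicalPhysics.QuantumFieldTheory.BalabanImbrieJaffe1984to88.BIJ85SmoothPotential326

open Balaban1983to89 hiding Site Plaq
open Balaban1983to89.LatticeFieldCalculus
open BIJ85AxialPropagator411 BIJ85Prop521Torus BIJ85Sigma421Torus BIJ85Eq611Torus BIJ85Prop522Torus BIJ85Sigma422Eta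
open BIJ85Sect7Statements BIJ85Ineq722Torus
open BIJ85Ineq722DeltaA (deltaAData)
open BIJ85GaugeFunction5113 (blk)
open BIJ88Ineq217Ineq722Torus (ofLp_HkE_single)
open BIJ85Ineq724Torus (supDist_blk_le_distEU)
open Balaban1983to89.B3TorusRadialSums (tdist_le_mul_supDist)
open BIJ85ResidualExact (sum_bond_growth_exp_le tdist_comm curlOp_apply')
open BIJ85ResidualConstants (resE_const constE_apply)
open BIJ85ResidualMinimizer (resE_dOne_eq_curlOp_HkE)
open BIJ85ResidualSupBound (resE_add dOne_pow_toEj altExt_eq_plaqCoch)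
open BIJ85UnitTorusHodge (plaqCoch IsClosedPlaq exists_const_add_curl_of_closed)
open BIJ85LineSumHk (ofLp_HkE_apply_eq_sum abs_HkE_apply_le_of_growth hH_of_kernelBounds)
open BIJ85Sect72AllToriHolds (exists_absH_le_allTori exists_gradB_allTori)
open BIJ85Sect1Model (U1Field plaq)
open BIJ85SmallFieldSplit64 (plaqField)
open BIJ85Eq454PlaqResidual (resE actualBg plaq_actualBg_eq_exp_resE)
open BIJ85Claim73Closed (dPlaq_plaqField_eq_zero altExt d₂_altExt_eq_zero_iff)
open BIJ85Claim73Residual (abs_plaqField_le_of_dev)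
-- inside this namespace the bare `Site`/`Plaq` are the `ℤ^d` carriers of the QFT root; the torus ones are renamed:
open Balaban1983to89 renaming Site → TSite, Plaq → TPlaq

noncomputable section

variable {P : Params}

/-! ## §0  Torus bookkeeping -/

/-- kernel: the least-absolute-value residue measures the torus distance of one coordinate. [folklore] -/
private theorem natAbs_valMinAbs_eq_min {n : ℕ} [NeZero n] (a : ZMod n) : a.valMinAbs.natAbs = min a.val (-a).val := by
  rw [ZMod.valMinAbs_natAbs_eq_min, ZMod.neg_val]
  split_ifs with h
  · subst h; simp
  · rfl

/-- kernel: triangle inequality for the `ℓ¹` torus distance of `T^{(j)}` (coordinatewise `ZMod.natAbs_valMinAbs_add_le`; the same fact as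
the B3 branch's `B3Taylor310LocalRemainder.tdist_triangle`, not imported into this branch). [folklore] -/
private theorem tdist_triangle {j : ℕ} (x y z : TSite P j) : x.tdist z ≤ x.tdist y + y.tdist z := by
  have e : ∀ u v : TSite P j, u.tdist v = ∑ μ : Fin P.d, ((u μ - v μ).valMinAbs).natAbs := fun u v => by
    unfold Balaban1983to89.Site.tdist
    exact Finset.sum_congr rfl fun μ _ => by rw [natAbs_valMinAbs_eq_min, neg_sub]
  rw [e, e, e, ← Finset.sum_add_distrib]
  refine Finset.sum_le_sum fun μ _ => ?_
  have h : x μ - z μ = (x μ - y μ) + (y μ - z μ) := by ring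
  rw [h]
  exact (ZMod.natAbs_valMinAbs_add_le _ _).trans (Int.natAbs_add_le _ _)

/-- kernel: **re-centring a quadratic growth weight** — `(1 + |y − x₀|₁)² ≤ (1 + |w − x₀|₁)²·(1 + |y − w|₁)²` (triangle inequality and
`1 + s + t ≤ (1 + s)(1 + t)`). [folklore] -/
private theorem growth_recentre {j : ℕ} (y w x₀ : TSite P j) :
    (1 + (y.tdist x₀ : ℝ)) ^ 2 ≤ (1 + (w.tdist x₀ : ℝ)) ^ 2 * (1 + (y.tdist w : ℝ)) ^ 2 := by
  have ht : (y.tdist x₀ : ℝ) ≤ (y.tdist w : ℝ) + (w.tdist x₀ : ℝ) := by exact_mod_cast tdist_triangle y w x₀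
  have h0 : (0 : ℝ) ≤ (y.tdist w : ℝ) := Nat.cast_nonneg _
  have h1 : (0 : ℝ) ≤ (w.tdist x₀ : ℝ) := Nat.cast_nonneg _
  rw [← mul_pow]
  have h2 : 1 + (y.tdist x₀ : ℝ) ≤ (1 + (w.tdist x₀ : ℝ)) * (1 + (y.tdist w : ℝ)) := by nlinarith
  exact pow_le_pow_left₀ (by positivity) h2 2

/-- kernel: a potential of quadratic growth about `x₀` has quadratic growth about ANY site `w`, at the price of the weight `(1 + |w − x₀|₁)²`.
[cite: BalabanImbrieJaffe1985, §7.3 p.326] -/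
theorem growth_about_of_growth_about {k : ℕ} {B : PBond P k → ℝ} {CB : ℝ} (hCB : 0 ≤ CB) {x₀ : TSite P k}
    (hB : ∀ b : PBond P k, |B b| ≤ CB * (1 + (b.src.tdist x₀ : ℝ)) ^ 2) (w : TSite P k) (b : PBond P k) :
    |B b| ≤ CB * (1 + (w.tdist x₀ : ℝ)) ^ 2 * (1 + (b.src.tdist w : ℝ)) ^ 2 := by
  refine (hB b).trans ?_
  rw [mul_assoc]
  exact mul_le_mul_of_nonneg_left (growth_recentre b.src w x₀) hCB

/-! ## §1  The `|∇H|` member of (7.2.2) in kernel shape for the Landau minimizer of record -/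

/-- **`hG` from the `|∇H|` member of (7.2.2) with explicit constants**: if `‖λ ↦ L^k(H_{k,μν}(x + ηe_λ; y) − H_{k,μν}(x; y))‖ ≤ M₀e^{−δ|x − y|}` for
the kernel of p09's torus carrier (`|x − y|` = the fine-site distance `distEU`), then the forward η-difference quotients of the column of
p11's `H_k = HkE P w c k` at the unit bond `b′ = ⟨y, ν⟩` obey `|L^k((H_ke_{b′})_κ(z + ηe_λ) − (H_ke_{b′})_κ(z))| ≤ M₀e^{δ/2}·e^{−(δ/d)|z_k − y|₁}` —
(7.2.1) `ofLp_HkE_single` and `|z_k − y|₁ ≤ d|z_k − y|_∞ ≤ d(|z − y| + ½)`. [cite: BalabanImbrieJaffe1985, (7.2.2) p.325] -/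
theorem hG_of_kernelBounds {k : ℕ} (hk : k ≤ P.m + P.K) {c : ℝ} (hc : c ≠ 0) {w : ℝ} (hw : 0 < w) {a : ℝ} (ha : 0 < a)
    {δ M₀ : ℝ} (hδ : 0 ≤ δ) (hM₀ : 0 ≤ M₀)
    (hG : ∀ (μ ν : Fin P.d) (x : TSite P 0) (y : TSite P k),
      ‖fun lam : Fin P.d => (P.L : ℝ) ^ k *
          ((torusRep P k (deltaAData hk a)).H (x.shift lam, μ) (y, ν) - (torusRep P k (deltaAData hk a)).H (x, μ) (y, ν))‖ ≤
        M₀ * Real.exp (-(δ * distEU P k x y)))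
    (z : TSite P 0) (κ lam : Fin P.d) (b : PBond P k) :
    |(P.L : ℝ) ^ k * (WithLp.ofLp (HkE P w c k (toEj P k (Pi.single b 1))) ⟨z.shift lam, κ⟩
        - WithLp.ofLp (HkE P w c k (toEj P k (Pi.single b 1))) ⟨z, κ⟩)| ≤
      M₀ * Real.exp (δ / 2) * Real.exp (-(δ / P.d) * ((blk k z).tdist b.src : ℝ)) := by
  have hd0 : (0 : ℝ) < P.d := by exact_mod_cast P.hd
  rw [ofLp_HkE_single hk hc hw ha b (z.shift lam) κ, ofLp_HkE_single hk hc hw ha b z κ]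
  have h1 : |(P.L : ℝ) ^ k * ((torusRep P k (deltaAData hk a)).H (z.shift lam, κ) (b.src, b.dir)
      - (torusRep P k (deltaAData hk a)).H (z, κ) (b.src, b.dir))| ≤ M₀ * Real.exp (-(δ * distEU P k z b.src)) := by
    have h := norm_le_pi_norm (fun lam' : Fin P.d => (P.L : ℝ) ^ k *
      ((torusRep P k (deltaAData hk a)).H (z.shift lam', κ) (b.src, b.dir) - (torusRep P k (deltaAData hk a)).H (z, κ) (b.src, b.dir))) lam
    rw [Real.norm_eq_abs] at h
    exact h.trans (hG κ b.dir z b.src)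
  have ht : ((blk k z).tdist b.src : ℝ) ≤ P.d * (distEU P k z b.src + 1 / 2) := by
    have h4 : ((blk k z).tdist b.src : ℝ) ≤ P.d * (supDist (blk k z) b.src : ℝ) := by
      exact_mod_cast tdist_le_mul_supDist (blk k z) b.src
    exact h4.trans (mul_le_mul_of_nonneg_left (supDist_blk_le_distEU hk z b.src) hd0.le)
  have hexp : Real.exp (-(δ * distEU P k z b.src)) ≤
      Real.exp (δ / 2) * Real.exp (-(δ / P.d) * ((blk k z).tdist b.src : ℝ)) := by
    rw [← Real.exp_add]
    refine Real.exp_le_exp.2 ?_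
    have h5 : δ / P.d * ((blk k z).tdist b.src : ℝ) ≤ δ * (distEU P k z b.src + 1 / 2) :=
      calc δ / P.d * ((blk k z).tdist b.src : ℝ)
          ≤ δ / P.d * (P.d * (distEU P k z b.src + 1 / 2)) := mul_le_mul_of_nonneg_left ht (div_nonneg hδ hd0.le)
        _ = δ * (distEU P k z b.src + 1 / 2) := by rw [← mul_assoc, div_mul_cancel₀ _ hd0.ne']
    linarith
  calc |(P.L : ℝ) ^ k * ((torusRep P k (deltaAData hk a)).H (z.shift lam, κ) (b.src, b.dir)
        - (torusRep P k (deltaAData hk a)).H (z, κ) (b.src, b.dir))|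
      ≤ M₀ * Real.exp (-(δ * distEU P k z b.src)) := h1
    _ ≤ M₀ * (Real.exp (δ / 2) * Real.exp (-(δ / P.d) * ((blk k z).tdist b.src : ℝ))) :=
        mul_le_mul_of_nonneg_left hexp hM₀
    _ = _ := by ring

/-! ## §2  The forward η-differences of `H_kB`: kernel sums and the local sup for a potential of quadratic growth -/

/-- **(7.2.1) for the forward η-differences**: `L^k((H_kB)_κ(z + ηe_λ) − (H_kB)_κ(z)) = Σ_{b′} L^k((H_ke_{b′})_κ(z + ηe_λ) − (H_ke_{b′})_κ(z))·B(b′)`.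
[cite: BalabanImbrieJaffe1985, (7.2.1) p.325] -/
theorem fwdDiff_HkE_apply_eq_sum (w c : ℝ) (k : ℕ) (B : PBond P k → ℝ) (z : TSite P 0) (κ lam : Fin P.d) :
    (P.L : ℝ) ^ k * (WithLp.ofLp (HkE P w c k (toEj P k B)) ⟨z.shift lam, κ⟩ - WithLp.ofLp (HkE P w c k (toEj P k B)) ⟨z, κ⟩) =
      ∑ b, (P.L : ℝ) ^ k * (WithLp.ofLp (HkE P w c k (toEj P k (Pi.single b 1))) ⟨z.shift lam, κ⟩
        - WithLp.ofLp (HkE P w c k (toEj P k (Pi.single b 1))) ⟨z, κ⟩) * B b := by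
  rw [ofLp_HkE_apply_eq_sum, ofLp_HkE_apply_eq_sum, ← Finset.sum_sub_distrib, Finset.mul_sum]
  exact Finset.sum_congr rfl fun b _ => by ring

/-- **THE LOCAL SUP OF `∇^ηH_kB` AT A FINE SITE**: if the forward differences of the columns obey
`|L^k((H_ke_{b′})_κ(z + ηe_λ) − (H_ke_{b′})_κ(z))| ≤ Me^{−δ|z_k − b′₋|₁}` (`M ≥ 0`, `δ > 0`; §1) and `|B(b′)| ≤ C_B(1 + |b′₋ − z_k|₁)²` (`C_B ≥ 0`), then
`|L^k((H_kB)_κ(z + ηe_λ) − (H_kB)_κ(z))| ≤ M·C_B·(1 + 4/δ)²·d·(2(1 + 2/δ))^d` (p30's row sum `sum_bond_growth_exp_le`).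
[cite: BalabanImbrieJaffe1985, (7.2.2) p.325] -/
theorem abs_fwdDiff_HkE_apply_le_of_growth {k : ℕ} (w c : ℝ) {M δ : ℝ} (hM : 0 ≤ M) (hδ : 0 < δ)
    (hG : ∀ (z : TSite P 0) (κ lam : Fin P.d) (b : PBond P k),
      |(P.L : ℝ) ^ k * (WithLp.ofLp (HkE P w c k (toEj P k (Pi.single b 1))) ⟨z.shift lam, κ⟩
          - WithLp.ofLp (HkE P w c k (toEj P k (Pi.single b 1))) ⟨z, κ⟩)| ≤ M * Real.exp (-δ * ((blk k z).tdist b.src : ℝ)))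
    (z : TSite P 0) (κ lam : Fin P.d) {B : PBond P k → ℝ} {CB : ℝ} (hCB : 0 ≤ CB)
    (hB : ∀ b : PBond P k, |B b| ≤ CB * (1 + (b.src.tdist (blk k z) : ℝ)) ^ 2) :
    |(P.L : ℝ) ^ k * (WithLp.ofLp (HkE P w c k (toEj P k B)) ⟨z.shift lam, κ⟩ - WithLp.ofLp (HkE P w c k (toEj P k B)) ⟨z, κ⟩)| ≤
      M * CB * ((1 + 4 / δ) ^ 2 * ((P.d : ℝ) * (2 * (1 + (δ / 2)⁻¹)) ^ P.d)) := by
  rw [fwdDiff_HkE_apply_eq_sum]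
  calc |∑ b, (P.L : ℝ) ^ k * (WithLp.ofLp (HkE P w c k (toEj P k (Pi.single b 1))) ⟨z.shift lam, κ⟩
          - WithLp.ofLp (HkE P w c k (toEj P k (Pi.single b 1))) ⟨z, κ⟩) * B b|
      ≤ ∑ b, |(P.L : ℝ) ^ k * (WithLp.ofLp (HkE P w c k (toEj P k (Pi.single b 1))) ⟨z.shift lam, κ⟩
          - WithLp.ofLp (HkE P w c k (toEj P k (Pi.single b 1))) ⟨z, κ⟩) * B b| := Finset.abs_sum_le_sum_abs _ _
    _ ≤ ∑ b : PBond P k, M * Real.exp (-δ * ((blk k z).tdist b.src : ℝ)) * (CB * (1 + (b.src.tdist (blk k z) : ℝ)) ^ 2) :=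
        Finset.sum_le_sum fun b _ => by
          rw [abs_mul]
          exact mul_le_mul (hG z κ lam b) (hB b) (abs_nonneg _) ((abs_nonneg _).trans (hG z κ lam b))
    _ = M * CB * ∑ b : PBond P k, (1 + ((blk k z).tdist b.src : ℝ)) ^ 2 * Real.exp (-δ * ((blk k z).tdist b.src : ℝ)) := by
        rw [Finset.mul_sum]
        refine Finset.sum_congr rfl fun b _ => ?_
        rw [tdist_comm b.src]
        ring
    _ ≤ _ := mul_le_mul_of_nonneg_left (sum_bond_growth_exp_le hδ (blk k z)) (mul_nonneg hM hCB)

/-! ## §3  One potential for the whole torus: growth measured from a fixed base site -/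

/-- **THE SUP OF `H_kB` WITH ONE POTENTIAL OF QUADRATIC GROWTH ABOUT A FIXED `x₀`** (*"with estimates depending on Λ"*): under the kernel shape
`|(H_ke_{b′})_κ(z)| ≤ Me^{−δ|z_k − b′₋|₁}` and `|B(b′)| ≤ C_B(1 + |b′₋ − x₀|₁)²`, at EVERY fine site `z`:
`|(H_kB)_κ(z)| ≤ M·C_B·(1 + 4/δ)²·d·(2(1 + 2/δ))^d·(1 + |z_k − x₀|₁)²`. [cite: BalabanImbrieJaffe1985, (7.2.2) p.325] -/
theorem abs_HkE_apply_le_of_growth_at {k : ℕ} (w c : ℝ) {M δ : ℝ} (hM : 0 ≤ M) (hδ : 0 < δ)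
    (hH : ∀ (z : TSite P 0) (κ : Fin P.d) (b : PBond P k),
      |WithLp.ofLp (HkE P w c k (toEj P k (Pi.single b 1))) ⟨z, κ⟩| ≤ M * Real.exp (-δ * ((blk k z).tdist b.src : ℝ)))
    {B : PBond P k → ℝ} {CB : ℝ} (hCB : 0 ≤ CB) {x₀ : TSite P k}
    (hB : ∀ b : PBond P k, |B b| ≤ CB * (1 + (b.src.tdist x₀ : ℝ)) ^ 2) (z : TSite P 0) (κ : Fin P.d) :
    |WithLp.ofLp (HkE P w c k (toEj P k B)) ⟨z, κ⟩| ≤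
      M * CB * ((1 + 4 / δ) ^ 2 * ((P.d : ℝ) * (2 * (1 + (δ / 2)⁻¹)) ^ P.d)) * (1 + ((blk k z).tdist x₀ : ℝ)) ^ 2 := by
  have hCB' : 0 ≤ CB * (1 + ((blk k z).tdist x₀ : ℝ)) ^ 2 := by positivity
  have h := abs_HkE_apply_le_of_growth w c hM hδ hH z κ hCB' (growth_about_of_growth_about hCB hB (blk k z))
  refine h.trans (le_of_eq ?_)
  ring

/-- **THE SUP OF `∇^ηH_kB` WITH ONE POTENTIAL OF QUADRATIC GROWTH ABOUT A FIXED `x₀`**: under the kernel shape of §1 and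
`|B(b′)| ≤ C_B(1 + |b′₋ − x₀|₁)²`, at EVERY fine site `z` and all directions `κ, λ`:
`|L^k((H_kB)_κ(z + ηe_λ) − (H_kB)_κ(z))| ≤ M·C_B·(1 + 4/δ)²·d·(2(1 + 2/δ))^d·(1 + |z_k − x₀|₁)²`. [cite: BalabanImbrieJaffe1985, (7.2.2) p.325] -/
theorem abs_fwdDiff_HkE_apply_le_of_growth_at {k : ℕ} (w c : ℝ) {M δ : ℝ} (hM : 0 ≤ M) (hδ : 0 < δ)
    (hG : ∀ (z : TSite P 0) (κ lam : Fin P.d) (b : PBond P k),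
      |(P.L : ℝ) ^ k * (WithLp.ofLp (HkE P w c k (toEj P k (Pi.single b 1))) ⟨z.shift lam, κ⟩
          - WithLp.ofLp (HkE P w c k (toEj P k (Pi.single b 1))) ⟨z, κ⟩)| ≤ M * Real.exp (-δ * ((blk k z).tdist b.src : ℝ)))
    {B : PBond P k → ℝ} {CB : ℝ} (hCB : 0 ≤ CB) {x₀ : TSite P k}
    (hB : ∀ b : PBond P k, |B b| ≤ CB * (1 + (b.src.tdist x₀ : ℝ)) ^ 2) (z : TSite P 0) (κ lam : Fin P.d) :
    |(P.L : ℝ) ^ k * (WithLp.ofLp (HkE P w c k (toEj P k B)) ⟨z.shift lam, κ⟩ - WithLp.ofLp (HkE P w c k (toEj P k B)) ⟨z, κ⟩)| ≤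
      M * CB * ((1 + 4 / δ) ^ 2 * ((P.d : ℝ) * (2 * (1 + (δ / 2)⁻¹)) ^ P.d)) * (1 + ((blk k z).tdist x₀ : ℝ)) ^ 2 := by
  have hCB' : 0 ≤ CB * (1 + ((blk k z).tdist x₀ : ℝ)) ^ 2 := by positivity
  have h := abs_fwdDiff_HkE_apply_le_of_growth w c hM hδ hG z κ lam hCB' (growth_about_of_growth_about hCB hB (blk k z))
  refine h.trans (le_of_eq ?_)
  ring

/-! ## §4  The curvature of the actual background is that of the fine field `exp[ie_kη(H_kB + a_h)]` -/

/-- **`u_k(∂p) = exp(ie_kη²·(h_{μν} + (∂^{η⁻¹}H_kB)(p)))` EXACTLY**: for every decomposition `f^{(k)} = h + ∂₁B` of the unit-lattice plaquette field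
`f^{(k)} = (ie_k)^{−1}ln v(∂·)` into a constant part `h` and a curl, the η-plaquette variables of the actual background (4.5.4) are those of the
fine field `exp[ie_kηA]` with `∂^ηA = h + ∂^ηH_kB` — Remark 2 p. 317 (`u_k(∂p) = exp(ie_kη²f_k(p))`, p33 g7), (4.2.6) on the constant part
(`f_k(h) = h`, p30) and on the curl (`f_k(∂B) = ∂^ηH_{k,Ax}B = ∂^ηH_kB` by (5.3.1) and (5.2.8)/(5.1.1), p33 g7: *"we use (5.3.1) to replace this by a
minimizer in axial gauge. Then we use (5.1.1) to return the minimizers to Landau gauge"*); `k ≤ m + K`, `2 ≤ d`, `e ≠ 0`, weights of record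
`w = η^d`, `c = η⁻¹ = L^k`. [cite: BalabanImbrieJaffe1985, §7.3 p.326] -/
theorem plaq_actualBg_eq_exp_hodge (hd : 2 ≤ P.d) {k : ℕ} (hk : k ≤ P.m + P.K) {e : ℝ} (he : e ≠ 0) (v : U1Field P k)
    {h : Fin P.d → Fin P.d → ℝ} {B : PBond P k → ℝ} (hdec : ∀ q : TPlaq P k, plaqField e v q = h q.μ q.ν + curl 1 B q)
    (p : TPlaq P 0) :
    plaq (actualBg hd k e v) p = Circle.exp (e * (P.eta k) ^ 2 *
      (h p.μ p.ν + curl ((P.L : ℝ) ^ k) (WithLp.ofLp (HkE P ((P.eta k) ^ P.d) ((P.L : ℝ) ^ k) k (toEj P k B))) p)) := by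
  have hw : 0 < (P.eta k) ^ P.d := pow_pos (eta_pos P k) _
  have hs : Real.sqrt ((P.eta k) ^ P.d) ≠ 0 := (Real.sqrt_pos.2 hw).ne'
  have hc : ((P.L : ℝ) ^ k) ≠ 0 := pow_ne_zero _ P.cast_L_pos.ne'
  rw [plaq_actualBg_eq_exp_resE hd hk he v p, eta_inv]
  congr 1
  have hsplit : toU P k (plaqField e v) = toU P k (fun q : TPlaq P k => h q.μ q.ν) + dOne P k ((P.L : ℝ) ^ k) (toEj P k B) := by
    rw [dOne_pow_toEj, ← map_add]
    congr 1
    funext q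
    exact hdec q
  rw [hsplit, resE_add, PiLp.add_apply, resE_const hd hk hc hw, constE_apply, resE_dOne_eq_curlOp_HkE hd hk hc hw, curlOp_apply',
    ← mul_add, ← mul_assoc, mul_assoc (e * (P.eta k) ^ 2), inv_mul_cancel₀ hs, mul_one]

/-! ## §5  Small plaquette variables: the plaquette field is closed and small -/

/-- **`f^{(k)}` IS CLOSED** (`IsClosedPlaq`, p30's cochain reading) when `|v(∂p) − 1| ≤ t ≤ ½`, `e > 0` — p33 g7's `dPlaq_plaqField_eq_zero`
(abelian Bianchi identity) read through `d₂_altExt_eq_zero_iff` (p. 326: *"f^{(k)} can locally be represented as a curl"*).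
[cite: BalabanImbrieJaffe1985, p.326 (text)] -/
theorem isClosedPlaq_plaqField_of_dev {j : ℕ} {e : ℝ} (he : 0 < e) (v : U1Field P j) {t : ℝ} (ht : t ≤ 1 / 2)
    (hv : ∀ p : TPlaq P j, ‖((plaq v p : Circle) : ℂ) - 1‖ ≤ t) : IsClosedPlaq (plaqField e v) := by
  unfold IsClosedPlaq
  rw [← altExt_eq_plaqCoch]
  exact (d₂_altExt_eq_zero_iff _).2 fun x μ ν lam hμν hνl => dPlaq_plaqField_eq_zero he v ht hv x hμν hνl

/-- `|f^{(k)}(p)| ≤ (π/2)·t/e` when `|v(∂p) − 1| ≤ t` (branch (2.11); chord versus arc). [cite: BalabanImbrieJaffe1985, (7.3.1) p.326] -/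
theorem abs_plaqField_le_of_dev' {j : ℕ} {e : ℝ} (he : 0 < e) (v : U1Field P j) {t : ℝ}
    (hv : ∀ p : TPlaq P j, ‖((plaq v p : Circle) : ℂ) - 1‖ ≤ t) (p : TPlaq P j) : |plaqField e v p| ≤ Real.pi / 2 * t / e :=
  (abs_plaqField_le_of_dev he v p).trans
    (div_le_div_of_nonneg_right (mul_le_mul_of_nonneg_left (hv p) (by positivity)) he.le)

/-- plaquettes exist (`d ≥ 2`), so `|v(∂p) − 1| ≤ t` forces `0 ≤ t`. [cite: BalabanImbrieJaffe1985, (2.1) p.304] -/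
theorem dev_nonneg (hd : 2 ≤ P.d) {j : ℕ} (v : U1Field P j) {t : ℝ} (hv : ∀ p : TPlaq P j, ‖((plaq v p : Circle) : ℂ) - 1‖ ≤ t) :
    0 ≤ t :=
  (norm_nonneg _).trans (hv ⟨fun _ => 0, ⟨0, by omega⟩, ⟨1, by omega⟩, by simp [Fin.lt_def]⟩)

/-! ## §6  One torus, one scale: the smooth small potential from the kernel shapes of (7.2.2) -/

/-- **THE SMOOTH SMALL POTENTIAL — one torus, one scale `k ≤ m + K`, from the `|H|` and `|∇H|` members of (7.2.2) in kernel shape**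
(`hH`: `|(H_ke_{b′})_κ(z)| ≤ Me^{−δ|z_k − b′₋|₁}`; `hG`: `|L^k((H_ke_{b′})_κ(z + ηe_λ) − (H_ke_{b′})_κ(z))| ≤ M′e^{−δ′|z_k − b′₋|₁}`; weights of record):
for every `e > 0`, every unit-lattice `U(1)` field `v` with `|v(∂p) − 1| ≤ t ≤ ½` and every base site `x₀ ∈ T^{(k)}` there are a constant
antisymmetric `h` (`|h_{μν}| ≤ (π/2)t/e`, the flux part of `f^{(k)}`) and a unit-lattice potential `B` of quadratic growth about `x₀`
(`|B(b)| ≤ (8d+2)(π/2)(t/e)(1 + |b₋ − x₀|₁)²`) such that (a) `u_k(∂p) = exp(ie_kη²(h_{μν} + (∂^ηH_kB)(p)))` on EVERY η-plaquette, and (b) the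
Landau minimizer `A = H_kB` is smooth and small: `|A_κ(z)| ≤ M(8d+2)(π/2)(t/e)C(δ)(1 + |z_k − x₀|₁)²`, `|L^k(A_κ(z + ηe_λ) − A_κ(z))| ≤
M′(8d+2)(π/2)(t/e)C(δ′)(1 + |z_k − x₀|₁)²`, `C(δ) = (1 + 4/δ)²d(2(1 + 2/δ))^d`. [cite: BalabanImbrieJaffe1985, §7.3 p.326] -/
theorem exists_smooth_potential (hd : 2 ≤ P.d) {k : ℕ} (hk : k ≤ P.m + P.K) {M δ M' δ' : ℝ} (hM : 0 ≤ M) (hδ : 0 < δ)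
    (hM' : 0 ≤ M') (hδ' : 0 < δ')
    (hH : ∀ (z : TSite P 0) (κ : Fin P.d) (b : PBond P k),
      |WithLp.ofLp (HkE P ((P.eta k) ^ P.d) ((P.L : ℝ) ^ k) k (toEj P k (Pi.single b 1))) ⟨z, κ⟩| ≤
        M * Real.exp (-δ * ((blk k z).tdist b.src : ℝ)))
    (hG : ∀ (z : TSite P 0) (κ lam : Fin P.d) (b : PBond P k),
      |(P.L : ℝ) ^ k * (WithLp.ofLp (HkE P ((P.eta k) ^ P.d) ((P.L : ℝ) ^ k) k (toEj P k (Pi.single b 1))) ⟨z.shift lam, κ⟩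
          - WithLp.ofLp (HkE P ((P.eta k) ^ P.d) ((P.L : ℝ) ^ k) k (toEj P k (Pi.single b 1))) ⟨z, κ⟩)| ≤
        M' * Real.exp (-δ' * ((blk k z).tdist b.src : ℝ)))
    {e : ℝ} (he : 0 < e) (v : U1Field P k) {t : ℝ} (ht : t ≤ 1 / 2)
    (hv : ∀ p : TPlaq P k, ‖((plaq v p : Circle) : ℂ) - 1‖ ≤ t) (x₀ : TSite P k) :
    ∃ (h : Fin P.d → Fin P.d → ℝ) (B : PBond P k → ℝ),
      (∀ μ ν, |h μ ν| ≤ Real.pi / 2 * t / e) ∧ (∀ μ, h μ μ = 0) ∧ (∀ μ ν, h ν μ = -h μ ν) ∧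
      (∀ b : PBond P k, |B b| ≤ (8 * P.d + 2) * (Real.pi / 2 * t / e) * (1 + (b.src.tdist x₀ : ℝ)) ^ 2) ∧
      (∀ p : TPlaq P 0, plaq (actualBg hd k e v) p = Circle.exp (e * (P.eta k) ^ 2 *
        (h p.μ p.ν + curl ((P.L : ℝ) ^ k) (WithLp.ofLp (HkE P ((P.eta k) ^ P.d) ((P.L : ℝ) ^ k) k (toEj P k B))) p))) ∧
      (∀ (z : TSite P 0) (κ : Fin P.d), |WithLp.ofLp (HkE P ((P.eta k) ^ P.d) ((P.L : ℝ) ^ k) k (toEj P k B)) ⟨z, κ⟩| ≤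
        M * ((8 * P.d + 2) * (Real.pi / 2 * t / e)) * ((1 + 4 / δ) ^ 2 * ((P.d : ℝ) * (2 * (1 + (δ / 2)⁻¹)) ^ P.d)) *
          (1 + ((blk k z).tdist x₀ : ℝ)) ^ 2) ∧
      (∀ (z : TSite P 0) (κ lam : Fin P.d),
        |(P.L : ℝ) ^ k * (WithLp.ofLp (HkE P ((P.eta k) ^ P.d) ((P.L : ℝ) ^ k) k (toEj P k B)) ⟨z.shift lam, κ⟩
            - WithLp.ofLp (HkE P ((P.eta k) ^ P.d) ((P.L : ℝ) ^ k) k (toEj P k B)) ⟨z, κ⟩)| ≤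
        M' * ((8 * P.d + 2) * (Real.pi / 2 * t / e)) * ((1 + 4 / δ') ^ 2 * ((P.d : ℝ) * (2 * (1 + (δ' / 2)⁻¹)) ^ P.d)) *
          (1 + ((blk k z).tdist x₀ : ℝ)) ^ 2) := by
  have ht0 : 0 ≤ t := dev_nonneg hd v hv
  have hs0 : 0 ≤ Real.pi / 2 * t / e := by positivity
  have hf : ∀ q : TPlaq P k, |plaqField e v q| ≤ Real.pi / 2 * t / e := abs_plaqField_le_of_dev' he v hv
  have hcl : IsClosedPlaq (plaqField e v) := isClosedPlaq_plaqField_of_dev he v ht hv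
  obtain ⟨h, B, hh, hdiag, hsw, hdec, hB⟩ := exists_const_add_curl_of_closed hcl hs0 hf x₀
  have hCB : 0 ≤ (8 * P.d + 2) * (Real.pi / 2 * t / e) := by positivity
  exact ⟨h, B, hh, hdiag, hsw, hB, fun p => plaq_actualBg_eq_exp_hodge hd hk he.ne' v hdec p,
    fun z κ => abs_HkE_apply_le_of_growth_at _ _ hM hδ hH hCB hB z κ,
    fun z κ lam => abs_fwdDiff_HkE_apply_le_of_growth_at _ _ hM' hδ' hG hCB hB z κ lam⟩

/-! ## §7  ALL TORI, HYPOTHESIS-FREE: one constant for every torus and every scale -/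

/-- **«A IS SMOOTH AND SMALL» — ONE CONSTANT FOR ALL TORI AND ALL SCALES, HYPOTHESIS-FREE**: for every dimension `d ≥ 2` and block size `L`
there is `K ≥ 0` such that on EVERY torus `P` with `P.d = d`, `P.L = L` (any volume exponent `m`, any number of steps `K`), at every scale
`1 ≤ k ≤ m + K`, for every coupling `e > 0`, every unit-lattice `U(1)` field `v` with `|v(∂p) − 1| ≤ t ≤ ½` and every base site `x₀`, there are
`h` (antisymmetric, `|h| ≤ (π/2)t/e`) and a unit potential `B` (`|B(b)| ≤ (8d+2)(π/2)(t/e)(1 + |b₋ − x₀|₁)²`) with the curvature identity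
`u_k(∂p) = exp(ie_kη²(h_{μν} + (∂^ηH_kB)(p)))` and `|(H_kB)_κ(z)|, |L^k((H_kB)_κ(z + ηe_λ) − (H_kB)_κ(z))| ≤ K·(t/e)·(1 + |z_k − x₀|₁)²` — the `|H|`
and `|∇H|` members of (7.2.2) over all tori (p16's `exists_absH_le_allTori`, `exists_gradB_allTori`, fed by [6I] Prop. 1.2 over all tori,
p19's `prop12Printed_allTori`) read in kernel shape (p09's `hH_of_kernelBounds`, §1) feeding §6.
[cite: BalabanImbrieJaffe1985, §7.3 p.326; Balaban1984PropagatorsI, Prop. 1.2 (1.110)–(1.114) pp.35–36] -/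
theorem exists_smooth_potential_allTori {d L : ℕ} (hd : 2 ≤ d) (hL : Odd L ∧ 1 < L) :
    ∃ K : ℝ, 0 ≤ K ∧ ∀ (P : Params) (hPd : P.d = d), P.L = L → ∀ (k : ℕ), 1 ≤ k → ∀ (hk : k ≤ P.m + P.K)
      (e : ℝ), 0 < e → ∀ (v : U1Field P k) (t : ℝ), t ≤ 1 / 2 → (∀ p : TPlaq P k, ‖((plaq v p : Circle) : ℂ) - 1‖ ≤ t) →
      ∀ x₀ : TSite P k, ∃ (h : Fin P.d → Fin P.d → ℝ) (B : PBond P k → ℝ),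
        (∀ μ ν, |h μ ν| ≤ Real.pi / 2 * t / e) ∧ (∀ μ, h μ μ = 0) ∧ (∀ μ ν, h ν μ = -h μ ν) ∧
        (∀ b : PBond P k, |B b| ≤ (8 * P.d + 2) * (Real.pi / 2 * t / e) * (1 + (b.src.tdist x₀ : ℝ)) ^ 2) ∧
        (∀ p : TPlaq P 0, plaq (actualBg (hd.trans_eq hPd.symm) k e v) p = Circle.exp (e * (P.eta k) ^ 2 *
          (h p.μ p.ν + curl ((P.L : ℝ) ^ k) (WithLp.ofLp (HkE P ((P.eta k) ^ P.d) ((P.L : ℝ) ^ k) k (toEj P k B))) p))) ∧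
        (∀ (z : TSite P 0) (κ : Fin P.d), |WithLp.ofLp (HkE P ((P.eta k) ^ P.d) ((P.L : ℝ) ^ k) k (toEj P k B)) ⟨z, κ⟩| ≤
          K * (t / e) * (1 + ((blk k z).tdist x₀ : ℝ)) ^ 2) ∧
        (∀ (z : TSite P 0) (κ lam : Fin P.d),
          |(P.L : ℝ) ^ k * (WithLp.ofLp (HkE P ((P.eta k) ^ P.d) ((P.L : ℝ) ^ k) k (toEj P k B)) ⟨z.shift lam, κ⟩
              - WithLp.ofLp (HkE P ((P.eta k) ^ P.d) ((P.L : ℝ) ^ k) k (toEj P k B)) ⟨z, κ⟩)| ≤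
          K * (t / e) * (1 + ((blk k z).tdist x₀ : ℝ)) ^ 2) := by
  have hd1 : 1 ≤ d := le_trans (by norm_num) hd
  have hd0 : (0 : ℝ) < d := by exact_mod_cast (Nat.lt_of_lt_of_le Nat.zero_lt_one hd1)
  obtain ⟨δ₁, M₁, hδ₁, hM₁, hH⟩ := exists_absH_le_allTori hd1 hL one_pos
  obtain ⟨δ₂, M₂, hδ₂, hM₂, hG⟩ := exists_gradB_allTori hd1 hL one_pos
  have hM₁' : 0 ≤ M₁ := zero_le_one.trans hM₁
  set C₁ : ℝ := M₁ * Real.exp (δ₁ / 2) * ((1 + 4 / (δ₁ / d)) ^ 2 * ((d : ℝ) * (2 * (1 + (δ₁ / d / 2)⁻¹)) ^ d)) with hC₁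
  set C₂ : ℝ := M₂ * Real.exp (δ₂ / 2) * ((1 + 4 / (δ₂ / d)) ^ 2 * ((d : ℝ) * (2 * (1 + (δ₂ / d / 2)⁻¹)) ^ d)) with hC₂
  have hC₁0 : 0 ≤ C₁ := by positivity
  have hC₂0 : 0 ≤ C₂ := by positivity
  refine ⟨(8 * d + 2) * (Real.pi / 2) * max C₁ C₂, by positivity, ?_⟩
  intro P hPd hPL k hk1 hk e he v t ht hv x₀
  subst hPd
  have hc : ((P.L : ℝ) ^ k) ≠ 0 := pow_ne_zero _ P.cast_L_pos.ne'
  have hw : 0 < (P.eta k) ^ P.d := pow_pos (eta_pos P k) _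
  have hHk : ∀ (z : TSite P 0) (κ : Fin P.d) (b : PBond P k),
      |WithLp.ofLp (HkE P ((P.eta k) ^ P.d) ((P.L : ℝ) ^ k) k (toEj P k (Pi.single b 1))) ⟨z, κ⟩| ≤
        M₁ * Real.exp (δ₁ / 2) * Real.exp (-(δ₁ / P.d) * ((blk k z).tdist b.src : ℝ)) := fun z κ b =>
    hH_of_kernelBounds hk hc hw one_pos hδ₁.le hM₁' (fun μ ν x y => hH P rfl hPL k hk1 hk μ ν x y) z κ b
  have hGk : ∀ (z : TSite P 0) (κ lam : Fin P.d) (b : PBond P k),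
      |(P.L : ℝ) ^ k * (WithLp.ofLp (HkE P ((P.eta k) ^ P.d) ((P.L : ℝ) ^ k) k (toEj P k (Pi.single b 1))) ⟨z.shift lam, κ⟩
          - WithLp.ofLp (HkE P ((P.eta k) ^ P.d) ((P.L : ℝ) ^ k) k (toEj P k (Pi.single b 1))) ⟨z, κ⟩)| ≤
        M₂ * Real.exp (δ₂ / 2) * Real.exp (-(δ₂ / P.d) * ((blk k z).tdist b.src : ℝ)) := fun z κ lam b =>
    hG_of_kernelBounds hk hc hw one_pos hδ₂.le hM₂ (fun μ ν x y => hG P rfl hPL k hk μ ν x y) z κ lam b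
  obtain ⟨h, B, hh, hdiag, hsw, hB, hplaq, hval, hgrad⟩ := exists_smooth_potential hd hk (by positivity) (div_pos hδ₁ hd0)
    (by positivity) (div_pos hδ₂ hd0) hHk hGk he v ht hv x₀
  have hte : 0 ≤ t / e := div_nonneg (dev_nonneg hd v hv) he.le
  refine ⟨h, B, hh, hdiag, hsw, hB, hplaq, fun z κ => (hval z κ).trans ?_, fun z κ lam => (hgrad z κ lam).trans ?_⟩
  · have e1 : M₁ * Real.exp (δ₁ / 2) * ((8 * P.d + 2) * (Real.pi / 2 * t / e)) *
          ((1 + 4 / (δ₁ / P.d)) ^ 2 * ((P.d : ℝ) * (2 * (1 + (δ₁ / P.d / 2)⁻¹)) ^ P.d)) * (1 + ((blk k z).tdist x₀ : ℝ)) ^ 2 =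
        (8 * P.d + 2) * (Real.pi / 2) * C₁ * (t / e) * (1 + ((blk k z).tdist x₀ : ℝ)) ^ 2 := by
      rw [hC₁]; ring
    rw [e1]
    gcongr
    exact le_max_left _ _
  · have e2 : M₂ * Real.exp (δ₂ / 2) * ((8 * P.d + 2) * (Real.pi / 2 * t / e)) *
          ((1 + 4 / (δ₂ / P.d)) ^ 2 * ((P.d : ℝ) * (2 * (1 + (δ₂ / P.d / 2)⁻¹)) ^ P.d)) * (1 + ((blk k z).tdist x₀ : ℝ)) ^ 2 =
        (8 * P.d + 2) * (Real.pi / 2) * C₂ * (t / e) * (1 + ((blk k z).tdist x₀ : ℝ)) ^ 2 := by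
      rw [hC₂]; ring
    rw [e2]
    gcongr
    exact le_max_right _ _

/-- **UNDER (7.3.1) VERBATIM — `|v(∂p) − 1| ≤ e_k𝓅(e_k)`, `𝓅(e_k) = (1 + ln e_k⁻¹)^𝓅`, `e_k𝓅(e_k) ≤ ½` — THE POTENTIAL IS `O(𝓅(e_k))`**: for every
`d ≥ 2`, `L` and exponent `𝓅` there is `K ≥ 0` (the constant of `exists_smooth_potential_allTori`) such that on every torus, every scale
`1 ≤ k ≤ m + K` and every base site, `|h| ≤ (π/2)𝓅(e_k)`, `|B(b)| ≤ (8d+2)(π/2)𝓅(e_k)(1 + |b₋ − x₀|₁)²`, the curvature identity holds and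
`|(H_kB)_κ(z)|, |L^k((H_kB)_κ(z + ηe_λ) − (H_kB)_κ(z))| ≤ K·𝓅(e_k)·(1 + |z_k − x₀|₁)²` — *"where A is smooth and small"*.
[cite: BalabanImbrieJaffe1985, (7.3.1) p.326, §7.3 p.326] -/
theorem exists_smooth_potential_of_hyp731 {d L : ℕ} (hd : 2 ≤ d) (hL : Odd L ∧ 1 < L) (pexp : ℝ) :
    ∃ K : ℝ, 0 ≤ K ∧ ∀ (P : Params) (hPd : P.d = d), P.L = L → ∀ (k : ℕ), 1 ≤ k → ∀ (hk : k ≤ P.m + P.K)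
      (e : ℝ), 0 < e → e * (1 + Real.log e⁻¹) ^ pexp ≤ 1 / 2 →
      ∀ (v : U1Field P k), (∀ p : TPlaq P k, ‖((plaq v p : Circle) : ℂ) - 1‖ ≤ e * (1 + Real.log e⁻¹) ^ pexp) →
      ∀ x₀ : TSite P k, ∃ (h : Fin P.d → Fin P.d → ℝ) (B : PBond P k → ℝ),
        (∀ μ ν, |h μ ν| ≤ Real.pi / 2 * (1 + Real.log e⁻¹) ^ pexp) ∧ (∀ μ, h μ μ = 0) ∧ (∀ μ ν, h ν μ = -h μ ν) ∧
        (∀ b : PBond P k, |B b| ≤ (8 * P.d + 2) * (Real.pi / 2 * (1 + Real.log e⁻¹) ^ pexp) * (1 + (b.src.tdist x₀ : ℝ)) ^ 2) ∧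
        (∀ p : TPlaq P 0, plaq (actualBg (hd.trans_eq hPd.symm) k e v) p = Circle.exp (e * (P.eta k) ^ 2 *
          (h p.μ p.ν + curl ((P.L : ℝ) ^ k) (WithLp.ofLp (HkE P ((P.eta k) ^ P.d) ((P.L : ℝ) ^ k) k (toEj P k B))) p))) ∧
        (∀ (z : TSite P 0) (κ : Fin P.d), |WithLp.ofLp (HkE P ((P.eta k) ^ P.d) ((P.L : ℝ) ^ k) k (toEj P k B)) ⟨z, κ⟩| ≤
          K * (1 + Real.log e⁻¹) ^ pexp * (1 + ((blk k z).tdist x₀ : ℝ)) ^ 2) ∧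
        (∀ (z : TSite P 0) (κ lam : Fin P.d),
          |(P.L : ℝ) ^ k * (WithLp.ofLp (HkE P ((P.eta k) ^ P.d) ((P.L : ℝ) ^ k) k (toEj P k B)) ⟨z.shift lam, κ⟩
              - WithLp.ofLp (HkE P ((P.eta k) ^ P.d) ((P.L : ℝ) ^ k) k (toEj P k B)) ⟨z, κ⟩)| ≤
          K * (1 + Real.log e⁻¹) ^ pexp * (1 + ((blk k z).tdist x₀ : ℝ)) ^ 2) := by
  obtain ⟨K, hK, hall⟩ := exists_smooth_potential_allTori hd hL
  refine ⟨K, hK, fun P hPd hPL k hk1 hk e he hsmall v hv x₀ => ?_⟩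
  obtain ⟨h, B, hh, hdiag, hsw, hB, hplaq, hval, hgrad⟩ :=
    hall P hPd hPL k hk1 hk e he v (e * (1 + Real.log e⁻¹) ^ pexp) hsmall hv x₀
  have hte : e * (1 + Real.log e⁻¹) ^ pexp / e = (1 + Real.log e⁻¹) ^ pexp := mul_div_cancel_left₀ _ he.ne'
  have hte' : Real.pi / 2 * (e * (1 + Real.log e⁻¹) ^ pexp) / e = Real.pi / 2 * (1 + Real.log e⁻¹) ^ pexp := by
    rw [mul_div_assoc, hte]
  refine ⟨h, B, fun μ ν => (hh μ ν).trans_eq hte', hdiag, hsw, fun b => (hB b).trans_eq (by rw [hte']), hplaq,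
    fun z κ => (hval z κ).trans_eq (by rw [hte]), fun z κ lam => (hgrad z κ lam).trans_eq (by rw [hte])⟩

end

end Literature.MathematicalPhysics.QuantumFieldTheory.BalabanImbrieJaffe1984to88.BIJ85SmoothPotential326
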